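import Summits.Ventures.PackingBounds.Energy.NewtonCertificateDeficit
import Summits.Ventures.PackingBounds.Configurations.E8Unique

/-!
# `E₈` is the UNIQUE ground state of `240` points on `S⁷` (Cohn–Kumar universal optimality, uniqueness clause)

Framing: lottery ticket; floor = certified bounds/negative ranges. Venture `PackingBounds` (cell
`pub-packcert`, seat `pub-packcert-energy`).

The tree proves universal optimality of the `E₈` roots (`Energy/UniversalOptimalityE8`: every `240`-point
`C ⊂ S⁷` has `a`-energy `≥ 240 (a(-1) + 56 a(-1/2) + 126 a(0) + 56 a(1/2))` for `a(t) = Σ c_k (1+t)^k`,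
`c_k ≥ 0`) and the uniqueness of the `240`-point kissing configuration (`Configurations/E8Unique`). Here the
two are joined through the deficit inequality of the Newton certificate
(`Energy/NewtonCertificateDeficit`): for `k ≥ 8` the `(1+t)^k`-energy exceeds the `E₈` value by at least
`Σ_{x≠y} (1+⟨x,y⟩)^{k-8} ω(1+⟨x,y⟩)` with `ω(u) = (u(u-1/2)(u-1)(u-3/2))²` (`ckPow_energy_deficit`), so a
configuration attaining the bound for a single `k ≥ 8` has all inner products in `{-1, -1/2, 0, 1/2}`, is a
kissing configuration, and is therefore isometric to the `E₈` root configuration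
(`isometric_E8_of_ckPow_energy_eq`). Consequently (`isometric_E8_of_energy_eq`): **for every potential
`a(t) = Σ_k c_k (1+t)^k` (`c_k ≥ 0`, convergent on `[-1,1)`) having some coefficient `c_k > 0` with `k ≥ 8`
— e.g. every inverse power law — a `240`-point configuration on `S⁷` with the minimal `a`-energy is
isometric to the `E₈` roots**: the ground state is unique up to isometry (Cohn–Kumar 2007, Thm. 1.2).

## References
* H. Cohn, A. Kumar, *Universally optimal distribution of points on spheres*, J. Amer. Math. Soc. 20 (2007)
  99–148, Theorem 1.2. [`CohnKumar2006`]
* E. Bannai, N. J. A. Sloane, Canad. J. Math. 33 (1981) 437–449 (= SPLAG Ch. 14 Thm. 7–8). [`ConwaySloane1999`]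
-/

noncomputable section

namespace Summit.Ventures.PackingBounds.Config.E8EnergyRigidity

open Finset Literature.Analysis.SpecialFunctions Literature.Geometry.DiscreteGeometry
  Summit.Ventures.PackingBounds.Energy

/-- `C_0^{(3)}` explicitly. -/
private theorem c3_0 (t : ℝ) : gegenbauerSum (3 : ℝ) 0 t = (1 : ℝ) := by
  simp [gegenbauerSum, gegenbauerCoeff]

/-- `C_1^{(3)}` explicitly. -/
private theorem c3_1 (t : ℝ) : gegenbauerSum (3 : ℝ) 1 t = (6 : ℝ) * t := by
  simp [gegenbauerSum, gegenbauerCoeff, Nat.factorial]; ring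

/-- `C_2^{(3)}` explicitly. -/
private theorem c3_2 (t : ℝ) : gegenbauerSum (3 : ℝ) 2 t = (-3 : ℝ) + (24 : ℝ) * t ^ 2 := by
  simp [gegenbauerSum, gegenbauerCoeff, Finset.sum_range_succ, Finset.prod_range_succ, Nat.factorial]
  ring

/-- `C_3^{(3)}` explicitly. -/
private theorem c3_3 (t : ℝ) : gegenbauerSum (3 : ℝ) 3 t = (-24 : ℝ) * t + (80 : ℝ) * t ^ 3 := by
  simp [gegenbauerSum, gegenbauerCoeff, Finset.sum_range_succ, Finset.prod_range_succ, Nat.factorial]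
  ring

/-- `C_4^{(3)}` explicitly. -/
private theorem c3_4 (t : ℝ) : gegenbauerSum (3 : ℝ) 4 t =
    (6 : ℝ) + (-120 : ℝ) * t ^ 2 + (240 : ℝ) * t ^ 4 := by
  simp [gegenbauerSum, gegenbauerCoeff, Finset.sum_range_succ, Finset.prod_range_succ, Nat.factorial]
  ring

/-- `C_5^{(3)}` explicitly. -/
private theorem c3_5 (t : ℝ) : gegenbauerSum (3 : ℝ) 5 t =
    (60 : ℝ) * t + (-480 : ℝ) * t ^ 3 + (672 : ℝ) * t ^ 5 := by
  simp [gegenbauerSum, gegenbauerCoeff, Finset.sum_range_succ, Finset.prod_range_succ, Nat.factorial]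
  ring

/-- `C_6^{(3)}` explicitly. -/
private theorem c3_6 (t : ℝ) : gegenbauerSum (3 : ℝ) 6 t =
    (-10 : ℝ) + (360 : ℝ) * t ^ 2 + (-1680 : ℝ) * t ^ 4 + (1792 : ℝ) * t ^ 6 := by
  simp [gegenbauerSum, gegenbauerCoeff, Finset.sum_range_succ, Finset.prod_range_succ, Nat.factorial]
  ring

/-- `C_7^{(3)}` explicitly. -/
private theorem c3_7 (t : ℝ) : gegenbauerSum (3 : ℝ) 7 t =
    (-120 : ℝ) * t + (1680 : ℝ) * t ^ 3 + (-5376 : ℝ) * t ^ 5 + (4608 : ℝ) * t ^ 7 := by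
  simp [gegenbauerSum, gegenbauerCoeff, Finset.sum_range_succ, Finset.prod_range_succ, Nat.factorial]
  ring

/-- Node values `v_i = 1 + t_i` of the `E₈` certificate (doubled sequence). -/
def v8 : ℕ → ℝ
  | 0 => 0 | 1 => 1 / 2 | 2 => 1 | 3 => 3 / 2 | 4 => 0 | 5 => 1 / 2 | 6 => 1 | 7 => 3 / 2 | _ => 0

/-- Distance distribution `(1, 56, 126, 56)` of the `E₈` roots at `t = -1, -1/2, 0, 1/2`. -/
def mult4 : ℕ → ℝ
  | 0 => 1 | 1 => 56 | 2 => 126 | 3 => 56 | _ => 0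

/-- Gegenbauer `C^{(3)}` expansion table of the eight Newton partial products (row `j`, column `i`). -/
def G8 (j i : ℕ) : ℝ :=
  match j with
  | 0 => (match i with | 0 => (1 : ℝ) | _ => 0)
  | 1 => (match i with | 0 => (1 : ℝ) | 1 => 1 / 6 | _ => 0)
  | 2 => (match i with | 0 => (5 / 8 : ℝ) | 1 => 1 / 4 | 2 => 1 / 24 | _ => 0)
  | 3 => (match i with | 0 => (3 / 16 : ℝ) | 1 => 2 / 15 | 2 => 1 / 16 | 3 => 1 / 80 | _ => 0)
  | 4 => (match i with
      | 0 => (1 / 160 : ℝ) | 1 => 1 / 120 | 2 => 1 / 96 | 3 => 1 / 80 | 4 => 1 / 240 | _ => 0)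
  | 5 => (match i with
      | 0 => (1 / 80 : ℝ) | 1 => 1 / 60 | 2 => 1 / 48 | 3 => 41 / 2240 | 4 => 1 / 120
      | 5 => 1 / 672 | _ => 0)
  | 6 => (match i with
      | 0 => (3 / 160 : ℝ) | 1 => 1 / 40 | 2 => 3 / 112 | 3 => 93 / 4480 | 4 => 43 / 3840
      | 5 => 5 / 1344 | 6 => 1 / 1792 | _ => 0)
  | 7 => (match i with
      | 0 => (3 / 160 : ℝ) | 1 => 7 / 320 | 2 => 9 / 448 | 3 => 39 / 2560 | 4 => 71 / 7680
      | 5 => 5 / 1152 | 6 => 5 / 3584 | 7 => 1 / 4608 | _ => 0)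
  | _ => 0

/-- The doubled node polynomial of the `E₈` certificate, `ω = ∏_{i<8} (1 + t - v_i)`, in the inner
product `t`. -/
def omega8 (t : ℝ) : ℝ := ∏ i ∈ range 8, (1 + t - v8 i)

/-- `ω` factored: `ω(t) = ((1+t)(t+1/2) t (t-1/2))²`. -/
theorem omega8_eq (t : ℝ) : omega8 t = ((1 + t) * (t + 1 / 2) * t * (t - 1 / 2)) ^ 2 := by
  simp only [omega8, Finset.prod_range_succ, Finset.prod_range_zero, v8]
  ring

/-- `ω ≥ 0`. -/
theorem omega8_nonneg (t : ℝ) : 0 ≤ omega8 t := by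
  rw [omega8_eq]; exact sq_nonneg _

/-- `ω(t) = 0` exactly at the `E₈` inner products `-1, -1/2, 0, 1/2`. -/
theorem omega8_eq_zero_iff (t : ℝ) :
    omega8 t = 0 ↔ t = -1 ∨ t = -1 / 2 ∨ t = 0 ∨ t = 1 / 2 := by
  rw [omega8_eq, sq_eq_zero_iff]
  constructor
  · intro h
    rcases mul_eq_zero.mp h with h | h
    · rcases mul_eq_zero.mp h with h | h
      · rcases mul_eq_zero.mp h with h | h
        · exact Or.inl (by linarith)
        · exact Or.inr (Or.inl (by linarith))
      · exact Or.inr (Or.inr (Or.inl h))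
    · exact Or.inr (Or.inr (Or.inr (by linarith)))
  · rintro (h | h | h | h) <;> rw [h] <;> norm_num

section config

variable {C : Finset (EuclideanSpace ℝ (Fin 8))} (h1 : ∀ x ∈ C, ‖x‖ = 1) (hN : C.card = 240)
include h1 hN

set_option maxHeartbeats 800000 in
open scoped Classical in
/-- **Deficit inequality for the `E₈` certificate.** For `k ≥ 8` and every `240`-point `C ⊂ S⁷`:
`240 Σ_i m_i (1+t_i)^k + Σ_{x≠y} (1+⟨x,y⟩)^{k-8} ω(⟨x,y⟩) ≤ Σ_{x≠y} (1+⟨x,y⟩)^k`.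
[cite: CohnKumar2006, Theorem 1.2 and §6] -/
theorem ckPow_energy_deficit (k : ℕ) (hk : 8 ≤ k) :
    (240 : ℝ) * ((1 + (-1 : ℝ)) ^ k + 56 * (1 + (-1 / 2 : ℝ)) ^ k
        + 126 * (1 + (0 : ℝ)) ^ k + 56 * (1 + (1 / 2 : ℝ)) ^ k) +
      ∑ x ∈ C, ∑ y ∈ C.erase x, (1 + inner ℝ x y) ^ (k - 8) * omega8 (inner ℝ x y) ≤
      ∑ x ∈ C, ∑ y ∈ C.erase x, (1 + inner ℝ x y) ^ k := by
  have key := NewtonCert.energy_deficit (n := 8) (μ := 3) (by norm_num) (by norm_num) 8 (by norm_num)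
    v8 ?hv ?hsq G8 ?hG ?hGid 240 4 (by norm_num) mult4 ?hdes k hk C h1 hN
  case hv => intro i; unfold v8; split <;> norm_num
  case hsq =>
    exact fun u _ => NewtonCert.omega_doubled_nonneg _ 4 (fun i hi => by
      interval_cases i <;> simp [v8]) u
  case hG =>
    intro j i
    unfold G8
    split <;> (first | (split <;> norm_num) | norm_num)
  case hGid =>
    intro j hj t
    interval_cases j
    · simp only [Finset.prod_range_zero, Finset.sum_range_succ, Finset.sum_range_zero,
        c3_0, c3_1, c3_2, c3_3, c3_4, c3_5, c3_6, c3_7, G8, v8]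
      ring
    · simp only [Finset.prod_range_succ, Finset.prod_range_zero, Finset.sum_range_succ,
        Finset.sum_range_zero, c3_0, c3_1, c3_2, c3_3, c3_4, c3_5, c3_6, c3_7, G8, v8]
      ring
    · simp only [Finset.prod_range_succ, Finset.prod_range_zero, Finset.sum_range_succ,
        Finset.sum_range_zero, c3_0, c3_1, c3_2, c3_3, c3_4, c3_5, c3_6, c3_7, G8, v8]
      ring
    · simp only [Finset.prod_range_succ, Finset.prod_range_zero, Finset.sum_range_succ,
        Finset.sum_range_zero, c3_0, c3_1, c3_2, c3_3, c3_4, c3_5, c3_6, c3_7, G8, v8]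
      ring
    · simp only [Finset.prod_range_succ, Finset.prod_range_zero, Finset.sum_range_succ,
        Finset.sum_range_zero, c3_0, c3_1, c3_2, c3_3, c3_4, c3_5, c3_6, c3_7, G8, v8]
      ring
    · simp only [Finset.prod_range_succ, Finset.prod_range_zero, Finset.sum_range_succ,
        Finset.sum_range_zero, c3_0, c3_1, c3_2, c3_3, c3_4, c3_5, c3_6, c3_7, G8, v8]
      ring
    · simp only [Finset.prod_range_succ, Finset.prod_range_zero, Finset.sum_range_succ,
        Finset.sum_range_zero, c3_0, c3_1, c3_2, c3_3, c3_4, c3_5, c3_6, c3_7, G8, v8]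
      ring
    · simp only [Finset.prod_range_succ, Finset.prod_range_zero, Finset.sum_range_succ,
        Finset.sum_range_zero, c3_0, c3_1, c3_2, c3_3, c3_4, c3_5, c3_6, c3_7, G8, v8]
      ring
  case hdes =>
    intro j hj
    interval_cases j <;> norm_num [Finset.prod_range_succ, Finset.prod_range_zero,
      Finset.sum_range_succ, Finset.sum_range_zero, G8, v8, mult4]
  have hval : ((240 : ℕ) : ℝ) * ∑ i ∈ range 4, mult4 i * v8 i ^ k =
      (240 : ℝ) * ((1 + (-1 : ℝ)) ^ k + 56 * (1 + (-1 / 2 : ℝ)) ^ k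
        + 126 * (1 + (0 : ℝ)) ^ k + 56 * (1 + (1 / 2 : ℝ)) ^ k) := by
    simp only [Finset.sum_range_succ, Finset.sum_range_zero, mult4, v8]
    push_cast
    ring
  rw [hval] at key
  exact key

/-- **Rigidity.** If a `240`-point `C ⊂ S⁷` attains the `E₈` value of the `(1+t)^k`-energy for one `k ≥ 8`,
then all its inner products are `≤ 1/2` (indeed in `{-1, -1/2, 0, 1/2}`): `C` is a kissing configuration. -/
theorem inner_le_half_of_ckPow_energy_eq (k : ℕ) (hk : 8 ≤ k)
    (hE : ∑ x ∈ C, ∑ y ∈ C.erase x, (1 + inner ℝ x y) ^ k =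
      (240 : ℝ) * ((1 + (-1 : ℝ)) ^ k + 56 * (1 + (-1 / 2 : ℝ)) ^ k
        + 126 * (1 + (0 : ℝ)) ^ k + 56 * (1 + (1 / 2 : ℝ)) ^ k)) :
    ∀ x ∈ C, ∀ y ∈ C, x ≠ y → inner ℝ x y ≤ 1 / 2 := by
  classical
  have hdef := ckPow_energy_deficit h1 hN k hk
  rw [hE] at hdef
  have hnn : ∀ x ∈ C, ∀ y ∈ C.erase x, 0 ≤ (1 + inner ℝ x y) ^ (k - 8) * omega8 (inner ℝ x y) := by
    intro x hx y hy
    have hb := NewtonCert.inner_mem_Ico_of_norm_eq_one (h1 x hx) (h1 y (Finset.mem_of_mem_erase hy))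
      (Finset.ne_of_mem_erase hy).symm
    exact mul_nonneg (pow_nonneg (by linarith [hb.1]) _) (omega8_nonneg _)
  have hsum0 : ∑ x ∈ C, ∑ y ∈ C.erase x, (1 + inner ℝ x y) ^ (k - 8) * omega8 (inner ℝ x y) = 0 :=
    le_antisymm (by linarith) (Finset.sum_nonneg fun x hx => Finset.sum_nonneg fun y hy => hnn x hx y hy)
  intro x hx y hy hxy
  have hyx : y ∈ C.erase x := Finset.mem_erase.mpr ⟨hxy.symm, hy⟩
  have hx0 := (Finset.sum_eq_zero_iff_of_nonneg fun x hx =>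
    Finset.sum_nonneg fun y hy => hnn x hx y hy).mp hsum0 x hx
  have hxy0 := (Finset.sum_eq_zero_iff_of_nonneg fun y hy => hnn x hx y hy).mp hx0 y hyx
  rcases mul_eq_zero.mp hxy0 with h | h
  · have : 1 + inner ℝ x y = 0 := pow_eq_zero_iff (by
      intro h0; rw [h0, pow_zero] at h; exact one_ne_zero h) |>.mp h
    linarith
  · rcases (omega8_eq_zero_iff _).mp h with h | h | h | h <;> rw [h] <;> norm_num

/-- **Unique ground state, polynomial form.** A `240`-point `C ⊂ S⁷` attaining the `E₈` value of the
`(1+t)^k`-energy for some `k ≥ 8` is isometric to the `E₈` root configuration. -/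
theorem isometric_E8_of_ckPow_energy_eq (k : ℕ) (hk : 8 ≤ k)
    (hE : ∑ x ∈ C, ∑ y ∈ C.erase x, (1 + inner ℝ x y) ^ k =
      (240 : ℝ) * ((1 + (-1 : ℝ)) ^ k + 56 * (1 + (-1 / 2 : ℝ)) ^ k
        + 126 * (1 + (0 : ℝ)) ^ k + 56 * (1 + (1 / 2 : ℝ)) ^ k)) :
    ∃ Ψ : EuclideanSpace ℝ (Fin 8) ≃ₗᵢ[ℝ] EuclideanSpace ℝ (Fin 8), C = E8.pts.image Ψ :=
  E8Unique.isometric_E8Roots C h1 (inner_le_half_of_ckPow_energy_eq h1 hN k hk hE) hN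

open scoped Classical in
/-- **Unique ground state (Cohn–Kumar Thm. 1.2, uniqueness for `E₈`).** Let `a(s) = Σ_k c_k (1+s)^k` with
`c_k ≥ 0`, convergent on `[-1,1)`, and `c_{k₀} > 0` for some `k₀ ≥ 8`. If a `240`-point configuration
`C ⊂ S⁷` has `a`-energy EQUAL to the universal lower bound `240 (a(-1) + 56 a(-1/2) + 126 a(0) + 56 a(1/2))`
(the `E₈` energy), then `C` is isometric to the `E₈` root configuration. [cite: CohnKumar2006, Theorem 1.2] -/
theorem isometric_E8_of_energy_eq (a : ℝ → ℝ) (c : ℕ → ℝ) (hc : ∀ k, 0 ≤ c k)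
    (ha : ∀ s : ℝ, -1 ≤ s → s < 1 → HasSum (fun k => c k * (1 + s) ^ k) (a s))
    (k₀ : ℕ) (hk₀ : 8 ≤ k₀) (hck₀ : 0 < c k₀)
    (hE : ∑ x ∈ C, ∑ y ∈ C.erase x, a (inner ℝ x y) =
      (240 : ℝ) * (a (-1) + 56 * a (-1 / 2) + 126 * a 0 + 56 * a (1 / 2))) :
    ∃ Ψ : EuclideanSpace ℝ (Fin 8) ≃ₗᵢ[ℝ] EuclideanSpace ℝ (Fin 8), C = E8.pts.image Ψ := by
  -- notation: `E k` the `(1+t)^k`-energy, `B k` the `E₈` value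
  set E : ℕ → ℝ := fun k => ∑ x ∈ C, ∑ y ∈ C.erase x, (1 + inner ℝ x y) ^ k with hEdef
  set B : ℕ → ℝ := fun k => (240 : ℝ) * ((1 + (-1 : ℝ)) ^ k + 56 * (1 + (-1 / 2 : ℝ)) ^ k
        + 126 * (1 + (0 : ℝ)) ^ k + 56 * (1 + (1 / 2 : ℝ)) ^ k) with hBdef
  have hEB : ∀ k, B k ≤ E k := fun k => UniversalE8.ckPow_energy_ge k C h1 hN
  -- `Σ_k c_k E_k = E_a(C)` and `Σ_k c_k B_k = bound`
  have hsC : ∀ x ∈ C, ∀ y ∈ C.erase x,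
      HasSum (fun k => c k * (1 + inner ℝ x y) ^ k) (a (inner ℝ x y)) := by
    intro x hx y hy
    have hb := NewtonCert.inner_mem_Ico_of_norm_eq_one (h1 x hx) (h1 y (Finset.mem_of_mem_erase hy))
      (Finset.ne_of_mem_erase hy).symm
    exact ha _ hb.1 hb.2
  have hR : HasSum (fun k => c k * E k) (∑ x ∈ C, ∑ y ∈ C.erase x, a (inner ℝ x y)) := by
    have h := hasSum_sum fun x (hx : x ∈ C) =>
      hasSum_sum fun y (hy : y ∈ C.erase x) => hsC x hx y hy
    refine h.congr_fun fun k => ?_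
    simp only [hEdef, Finset.mul_sum]
  have hm1 := ha (-1) (by norm_num) (by norm_num)
  have hm2 := ha (-1 / 2) (by norm_num) (by norm_num)
  have hm3 := ha 0 (by norm_num) (by norm_num)
  have hm4 := ha (1 / 2) (by norm_num) (by norm_num)
  have hL : HasSum (fun k => c k * B k)
      ((240 : ℝ) * (a (-1) + 56 * a (-1 / 2) + 126 * a 0 + 56 * a (1 / 2))) := by
    have h := ((hm1.add ((hm2.mul_left 56).add ((hm3.mul_left 126).add (hm4.mul_left 56)))).mul_left
      (240 : ℝ))
    rw [show (240 : ℝ) * (a (-1) + 56 * a (-1 / 2) + 126 * a 0 + 56 * a (1 / 2)) =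
      240 * (a (-1) + (56 * a (-1 / 2) + (126 * a 0 + 56 * a (1 / 2)))) by ring]
    refine h.congr_fun fun k => ?_
    simp only [hBdef]
    ring
  -- the nonnegative series `Σ c_k (E_k - B_k)` sums to `0`
  have hdiff : HasSum (fun k => c k * (E k - B k)) 0 := by
    have h := hR.sub hL
    rw [hE, sub_self] at h
    refine h.congr_fun fun k => ?_
    ring
  have hnonneg : ∀ k, 0 ≤ c k * (E k - B k) := fun k =>
    mul_nonneg (hc k) (by linarith [hEB k])
  have hzero := (hasSum_zero_iff_of_nonneg hnonneg).mp hdiff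
  have hk0 : c k₀ * (E k₀ - B k₀) = 0 := by
    have := congrFun hzero k₀
    simpa using this
  have hEq : E k₀ = B k₀ := by
    rcases mul_eq_zero.mp hk0 with h | h
    · exact absurd h hck₀.ne'
    · linarith
  exact isometric_E8_of_ckPow_energy_eq h1 hN k₀ hk₀ hEq

end config

end Summit.Ventures.PackingBounds.Config.E8EnergyRigidity

end
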